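import Summits.MatrixMultiplication.MatrixMultiplication.Theorems.AbelianSTPPCensusShapeCertVQDefsP

/-!
# Abelian STPP census — kernel evaluation of the budgeted vQ certificate at order 415, path segments (part c)

Cell mm-stpp, rung F-M1; successor kernel item VQ-CERT (T_E beyond 337 under vQ := vP ∧ E3⁺) in support of the closed crux item
stmt-MatrixMultiplication-19191; seat mm-stpp-vp-p2 (gen 1); support file (no definitions).  PATH SEGMENTS `ShapeCertVQ.pathSegQE M path i n`
(`…ShapeCertVQDefsP`) of `ShapeCertVQ.checkQE 415`: the node-level decision of the budgeted search at the node reached by the candidate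
indices `path` (last step first; `[]` = root) and the walk of its pool's candidates `i … i+n−1`, each by `decide +kernel` (no
`native_decide`, standard axioms, `Elab.async false`), sized from the seat's per-node cost profile (calc/pathplan_*.txt, cost = visits +
nodes ≤ 4.5·10³ where the tree allows).  Assembled into `checkQE 415 = true` in `…ShapeCertVQEvalP415` by the lemmas of `…ShapeCertVQSearchP`.
WHAT THIS IS NOT: Boolean evaluations; no statement about STPP families or `ω` by themselves.
-/

set_option linter.dupNamespace false -- `MatrixMultiplication.MatrixMultiplication` (summit = problem, D-0017)
set_option autoImplicit false
set_option Elab.async false -- sequential kernel evaluations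

namespace Summit.MatrixMultiplication.MatrixMultiplication.Theorems.ShapeCertVQ

set_option maxHeartbeats 0 in
/-- path segment of the budgeted vQ certificate at order `415`: node `[91]` (last step first), candidates `20 …` (cost ≈ 2367; kernel evaluation) -/
theorem ps_415_r_91_20 : pathSegQE 415 [91] 20 9999 = true := by
  decide +kernel

set_option maxHeartbeats 0 in
/-- path segment of the budgeted vQ certificate at order `415`: node `[]` (last step first), candidates `92 … 109` (cost ≈ 4212; kernel evaluation) -/
theorem ps_415_r_92 : pathSegQE 415 [] 92 18 = true := by
  decide +kernel

set_option maxHeartbeats 0 in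
/-- path segment of the budgeted vQ certificate at order `415`: node `[]` (last step first), candidates `110 … 112` (cost ≈ 4150; kernel evaluation) -/
theorem ps_415_r_110 : pathSegQE 415 [] 110 3 = true := by
  decide +kernel

set_option maxHeartbeats 0 in
/-- path segment of the budgeted vQ certificate at order `415`: node `[]` (last step first), candidates `113 … 954` (cost ≈ 4500; kernel evaluation) -/
theorem ps_415_r_113 : pathSegQE 415 [] 113 842 = true := by
  decide +kernel

set_option maxHeartbeats 0 in
/-- path segment of the budgeted vQ certificate at order `415`: node `[]` (last step first), candidates `955 …` (cost ≈ 4443; kernel evaluation) -/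
theorem ps_415_r_955 : pathSegQE 415 [] 955 9999 = true := by
  decide +kernel

end Summit.MatrixMultiplication.MatrixMultiplication.Theorems.ShapeCertVQ
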